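import Summits.Ventures.HodgeRepro2.T5SU11ResolventGroundStateTransformIterates

/-!
# The Neumann series of the resolvent in `L¹(Ξ sinh 2t dt)` on the sharp disc

Row 558's bound `∫ |G^I_λ g| Ξ sinh 2t ≤ (∫ |g| Ξ sinh 2s)/(λ − 1)²` iterates (row 572 keeps the iterates in
`L¹(Ξ sinh 2t dt)`, row 503 in the class), and row 503's finite Neumann expansion then gives the `L¹(Ξ sinh 2t dt)` version
of rows 555 (`L²`) and 557 (`W_1`):

* `iterate_l1_ground` — **`∫ |(G^I_λ)ⁿ g| Ξ sinh 2t ≤ (∫ |g| Ξ sinh 2s)/((λ − 1)²)ⁿ`**;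
* `integral_abs_neumann_remainder_ground` — **`∫ |G^I_λ g − Σ_{k ≤ n} (μ − μ₂)^k (G^I_{λ₂})^{k+1} g| Ξ sinh 2t ≤
  (|μ − μ₂|/(λ₂ − 1)²)^{n+1} (∫ |g| Ξ sinh 2s)/(λ − 1)²`**;
* `tendsto_neumann_l1_ground` — **the Neumann series converges to `G^I_λ g` in `L¹(Ξ sinh 2t dt)` on the sharp disc
  `|μ − μ₂| < (λ₂ − 1)²`**, for every source of the class in `L¹(Ξ sinh 2t dt)`.

Nothing is claimed about (N).

Blind lane: Mathlib + the HodgeRepro2 prefix only; no sorry; axioms ⊆ {propext, Classical.choice,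
Quot.sound}.
-/

namespace Summit.Ventures.HodgeRepro2.T5SU11ResolventL1GroundStateNeumann

open Filter Topology MeasureTheory
open Set (Ioi Ioc)
open T5SU11Cartan T5SU11SphericalFunction T5SU11SphericalDecay T5SU11RadialGreenImproper T5SU11SphericalBounds
  T5SU11ResolventNeumann T5SU11ResolventL1GroundState T5SU11ResolventGroundStateTransformIterates

section measure

variable [MeasurableSpace Circle] [BorelSpace Circle]

variable {lam : ℝ} (hlam : 1 < lam) {g : ℝ → ℝ} (hg : ContinuousOn g (Ioi 0))
  {M : ℝ} (hM : ∀ s ∈ Ioc (0 : ℝ) 1, |g s| ≤ M) (hM0 : 0 ≤ M)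
  {ε C s₀ : ℝ} (hε : 2 - lam < ε) (hC : ∀ s, s₀ ≤ s → |g s| ≤ C * Real.exp (-ε * s))
  (hg1 : IntegrableOn (fun s => |g s| * sph 1 (hyp s) * Real.sinh (2 * s)) (Ioi 0))

include hlam hg hM hM0 hε hC hg1 in
/-- **THE ITERATES IN `L¹(Ξ sinh 2t dt)`**: `∫ |(G^I_λ)ⁿ g| Ξ sinh 2t ≤ (∫ |g| Ξ sinh 2s)/((λ − 1)²)ⁿ` for every `n`. -/
theorem iterate_l1_ground (n : ℕ) :
    ∫ t in Ioi 0, |((greenSolI (fun t => sph lam (hyp t)) (sphDecay lam))^[n] g) t| * sph 1 (hyp t) * Real.sinh (2 * t)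
      ≤ (∫ s in Ioi 0, |g s| * sph 1 (hyp s) * Real.sinh (2 * s)) / ((lam - 1) ^ 2) ^ n := by
  induction n with
  | zero => simp
  | succ n ih =>
    have hmin : 2 - lam < min ε lam := lt_min hε (by linarith)
    obtain ⟨hcont, ⟨M', hM'0, hM'⟩, hdec⟩ := iterate_class (lam₂ := lam) hlam hg hM hM0 hε hC n
    obtain ⟨K, T, _, _, hKT⟩ := hdec ((2 - lam + min ε lam) / 2) (by linarith)
    have hε' : 2 - lam < (2 - lam + min ε lam) / 2 := by linarith
    have hmem := (iterate_transform_ground hlam hg hM hM0 hε hC hg1 n).1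
    have hp : 0 < (lam - 1) ^ 2 := by
      have : 0 < lam - 1 := by linarith
      positivity
    rw [Function.iterate_succ_apply']
    calc ∫ t in Ioi 0, |greenSolI (fun t => sph lam (hyp t)) (sphDecay lam)
          ((greenSolI (fun t => sph lam (hyp t)) (sphDecay lam))^[n] g) t| * sph 1 (hyp t) * Real.sinh (2 * t)
        ≤ (∫ s in Ioi 0, |((greenSolI (fun t => sph lam (hyp t)) (sphDecay lam))^[n] g) s| * sph 1 (hyp s)
            * Real.sinh (2 * s)) / (lam - 1) ^ 2 :=
          integral_abs_greenSolI_mul_sph_one_mul_sinh_le hlam hcont hM' hM'0 hε' hKT hmem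
      _ ≤ ((∫ s in Ioi 0, |g s| * sph 1 (hyp s) * Real.sinh (2 * s)) / ((lam - 1) ^ 2) ^ n) / (lam - 1) ^ 2 :=
          div_le_div_of_nonneg_right ih hp.le
      _ = (∫ s in Ioi 0, |g s| * sph 1 (hyp s) * Real.sinh (2 * s)) / ((lam - 1) ^ 2) ^ (n + 1) := by
          rw [pow_succ ((lam - 1) ^ 2) n, div_div]

include hlam hg hM hM0 hε hC hg1 in
/-- **THE `L¹(Ξ sinh 2t dt)` BOUND OF THE NEUMANN REMAINDER**:
`∫ |G^I_λ g − Σ_{k=0}^{n} (μ − μ₂)^k (G^I_{λ₂})^{k+1} g| Ξ sinh 2t ≤ (|μ − μ₂|/(λ₂ − 1)²)^{n+1} (∫ |g| Ξ sinh 2s)/(λ − 1)²`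
for `λ, λ₂ > 1` and a source of the class (rate `ε > max(2 − λ, 2 − λ₂)`) in `L¹(Ξ sinh 2t dt)`. -/
theorem integral_abs_neumann_remainder_ground {lam₂ : ℝ} (hlam₂ : 1 < lam₂) (hε₂ : 2 - lam₂ < ε) (n : ℕ) :
    ∫ t in Ioi 0, |greenSolI (fun t => sph lam (hyp t)) (sphDecay lam) g t
        - ∑ k ∈ Finset.range (n + 1), (lam * (lam - 2) - lam₂ * (lam₂ - 2)) ^ k
          * (greenSolI (fun t => sph lam₂ (hyp t)) (sphDecay lam₂))^[k + 1] g t| * sph 1 (hyp t) * Real.sinh (2 * t)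
      ≤ (|lam * (lam - 2) - lam₂ * (lam₂ - 2)| / (lam₂ - 1) ^ 2) ^ (n + 1)
          * ((∫ s in Ioi 0, |g s| * sph 1 (hyp s) * Real.sinh (2 * s)) / (lam - 1) ^ 2) := by
  set κ := lam * (lam - 2) - lam₂ * (lam₂ - 2) with hκ
  set h := (greenSolI (fun t => sph lam₂ (hyp t)) (sphDecay lam₂))^[n + 1] g with hh
  -- the class data of `h` at a rate `ε′ ∈ (2 − λ, min(ε, λ₂))`, and its `L¹(Ξ sinh)` membership and bound at `λ₂`
  have hmin : 2 - lam < min ε lam₂ := lt_min hε (by linarith)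
  obtain ⟨hcont, ⟨M', hM'0, hM'⟩, hdec⟩ := iterate_class hlam₂ hg hM hM0 hε₂ hC (n + 1)
  obtain ⟨K, T, _, _, hKT⟩ := hdec ((2 - lam + min ε lam₂) / 2) (by linarith)
  have hε' : 2 - lam < (2 - lam + min ε lam₂) / 2 := by linarith
  have hmem := (iterate_transform_ground hlam₂ hg hM hM0 hε₂ hC hg1 (n + 1)).1
  have hhB := iterate_l1_ground hlam₂ hg hM hM0 hε₂ hC hg1 (n + 1)
  -- the pointwise remainder identity (row 503)
  have e : ∫ t in Ioi 0, |greenSolI (fun t => sph lam (hyp t)) (sphDecay lam) g t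
        - ∑ k ∈ Finset.range (n + 1), κ ^ k * (greenSolI (fun t => sph lam₂ (hyp t)) (sphDecay lam₂))^[k + 1] g t|
        * sph 1 (hyp t) * Real.sinh (2 * t)
      = |κ| ^ (n + 1) * ∫ t in Ioi 0, |greenSolI (fun t => sph lam (hyp t)) (sphDecay lam) h t| * sph 1 (hyp t)
        * Real.sinh (2 * t) := by
    rw [← MeasureTheory.integral_const_mul]
    apply setIntegral_congr_fun measurableSet_Ioi
    intro t ht
    have ht0 : 0 < t := ht
    simp only
    rw [neumann_finite hlam hlam₂ hg hM hM0 hε hε₂ hC n ht0, add_sub_cancel_left, abs_mul, abs_pow]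
    ring
  rw [e]
  have h1 := integral_abs_greenSolI_mul_sph_one_mul_sinh_le hlam hcont hM' hM'0 hε' hKT hmem
  have hp1 : 0 < (lam - 1) ^ 2 := by
    have : 0 < lam - 1 := by linarith
    positivity
  have hp2 : 0 < ((lam₂ - 1) ^ 2) ^ (n + 1) := by
    have : 0 < lam₂ - 1 := by linarith
    positivity
  calc |κ| ^ (n + 1) * ∫ t in Ioi 0, |greenSolI (fun t => sph lam (hyp t)) (sphDecay lam) h t| * sph 1 (hyp t)
        * Real.sinh (2 * t)
      ≤ |κ| ^ (n + 1) * ((∫ s in Ioi 0, |h s| * sph 1 (hyp s) * Real.sinh (2 * s)) / (lam - 1) ^ 2) :=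
        mul_le_mul_of_nonneg_left h1 (pow_nonneg (abs_nonneg _) _)
    _ ≤ |κ| ^ (n + 1) * (((∫ s in Ioi 0, |g s| * sph 1 (hyp s) * Real.sinh (2 * s)) / ((lam₂ - 1) ^ 2) ^ (n + 1))
          / (lam - 1) ^ 2) :=
        mul_le_mul_of_nonneg_left (div_le_div_of_nonneg_right hhB hp1.le) (pow_nonneg (abs_nonneg _) _)
    _ = (|κ| / (lam₂ - 1) ^ 2) ^ (n + 1) * ((∫ s in Ioi 0, |g s| * sph 1 (hyp s) * Real.sinh (2 * s)) / (lam - 1) ^ 2) := by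
        rw [div_pow]
        field_simp

include hlam hg hM hM0 hε hC hg1 in
/-- **THE NEUMANN SERIES CONVERGES IN `L¹(Ξ sinh 2t dt)` ON THE SHARP DISC** `|μ − μ₂| < (λ₂ − 1)²`:
`∫ |G^I_λ g − Σ_{k=0}^{n} (μ − μ₂)^k (G^I_{λ₂})^{k+1} g| Ξ sinh 2t → 0`. -/
theorem tendsto_neumann_l1_ground {lam₂ : ℝ} (hlam₂ : 1 < lam₂) (hε₂ : 2 - lam₂ < ε)
    (hq : |lam * (lam - 2) - lam₂ * (lam₂ - 2)| < (lam₂ - 1) ^ 2) :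
    Tendsto (fun n : ℕ => ∫ t in Ioi 0, |greenSolI (fun t => sph lam (hyp t)) (sphDecay lam) g t
        - ∑ k ∈ Finset.range (n + 1), (lam * (lam - 2) - lam₂ * (lam₂ - 2)) ^ k
          * (greenSolI (fun t => sph lam₂ (hyp t)) (sphDecay lam₂))^[k + 1] g t| * sph 1 (hyp t) * Real.sinh (2 * t))
      atTop (𝓝 0) := by
  have hp2 : 0 < (lam₂ - 1) ^ 2 := by
    have : 0 < lam₂ - 1 := by linarith
    positivity
  set q := |lam * (lam - 2) - lam₂ * (lam₂ - 2)| / (lam₂ - 1) ^ 2 with hq_def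
  have hq0 : 0 ≤ q := by positivity
  have hq1 : q < 1 := by rw [hq_def, div_lt_one hp2]; exact hq
  set Kc := (∫ s in Ioi 0, |g s| * sph 1 (hyp s) * Real.sinh (2 * s)) / (lam - 1) ^ 2 with hKc
  have hlim : Tendsto (fun n : ℕ => q ^ (n + 1) * Kc) atTop (𝓝 0) := by
    have h := ((tendsto_pow_atTop_nhds_zero_of_lt_one hq0 hq1).comp (tendsto_add_atTop_nat 1)).mul_const Kc
    rwa [zero_mul] at h
  refine squeeze_zero (fun n => ?_)
    (fun n => integral_abs_neumann_remainder_ground hlam hg hM hM0 hε hC hg1 hlam₂ hε₂ n) hlim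
  apply setIntegral_nonneg measurableSet_Ioi
  intro t ht
  have ht0 : 0 < t := ht
  exact mul_nonneg (mul_nonneg (abs_nonneg _) (sph_hyp_pos 1 t).le) (Real.sinh_nonneg_iff.mpr (by linarith))

end measure

end Summit.Ventures.HodgeRepro2.T5SU11ResolventL1GroundStateNeumann
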